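import Mathlib
import Summits.Ventures.PercRepro2.LocRows
import Summits.Ventures.PercRepro2.SwRow
import Summits.Ventures.PercRepro2.SwOut

/-!
# Statement (HLC), general form: the conditioned region need not contain `l`
(blind cell PercRepro2, night-4 g9, 2026-08-25; proofs/NIGHT4-G9.md §4 «GENERALISATION»)

`SwOut` (SwOut.lean) conditions row (SW) on the colouring of a region `W = Uᶜ ∋ l` that the hull of
`h` avoids.  The census says the hypothesis `l ∈ W` is not needed: for EVERY vertex set `U ∋ h` and
every `ξ`, the class `{ζ ∈ Q : ζ = ξ off touches U, hull ζ h ⊆ U}` is dominated (0 failures on all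
connected graphs with n ≤ 6 and on the NEG-50 / NEG-93 / NEG-115 graphs for the regions containing
neither `l` nor `h`).  `SwOutGen` is that statement; `swOut_of_swOutGen` specialises it to `SwOut`,
hence (`sw_of_swOut`) to row (SW).
-/

namespace Summit.Ventures.PercRepro2

namespace LocRows

open Hull

variable {V : Type*} {E : Type*} [Fintype E] [DecidableEq E]

open scoped Classical

variable (ends : E → Sym2 V)

/-- **Statement (HLC), general form**: for every region `U ∋ h` (whether or not `l ∈ U`) and every
outside colouring `ξ`, an injection of `Q ∩ outClass U h ξ` into itself carrying the red cluster of
`h` into the blue cluster of `h` of the image. -/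
def SwOutGen (l h o : V) : Prop :=
  ∀ (U : Set V) (ξ : Config E), h ∈ U →
    ∃ f : {ζ // ζ ∈ swOutSide ends l h o U ξ} → Config E, Function.Injective f ∧
      ∀ x, f x ∈ swOutSide ends l h o U ξ ∧ cluster ends x.1 h ⊆ cluster ends (blue (f x)) h

variable {ends}

/-- The general form gives `SwOut`. -/
theorem swOut_of_swOutGen {l h o : V} (hs : SwOutGen ends l h o) : SwOut ends l h o :=
  fun U ξ hU _ => hs U ξ hU

/-- The general form gives row (SW). -/
theorem sw_of_swOutGen (l h o : V) (hlh : l ≠ h) (hs : SwOutGen ends l h o) : Sw ends l h o :=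
  sw_of_swOut l h o hlh (swOut_of_swOutGen hs)

variable (ends)

/-- The general form over all finite graphs and markings. -/
def SwOutGen_all : Prop :=
  ∀ (V E : Type) [Fintype V] [DecidableEq V] [Fintype E] [DecidableEq E] (ends : E → Sym2 V)
    (l h o : V), l ≠ h → o ≠ l → o ≠ h → SwOutGen ends l h o

/-- `SwOutGen_all` gives `SwOut_all`. -/
theorem swOut_all_of_swOutGen_all (hs : SwOutGen_all) : SwOut_all := by
  intro V E _ _ _ _ ends l h o hlh hol hoh
  exact swOut_of_swOutGen (hs V E ends l h o hlh hol hoh)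

/-- `SwOutGen_all` gives `Sw_all`. -/
theorem sw_all_of_swOutGen_all (hs : SwOutGen_all) : Sw_all :=
  sw_all_of_swOut_all (swOut_all_of_swOutGen_all hs)

end LocRows

end Summit.Ventures.PercRepro2
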